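import Mathlib
import Summits.CriticalPhenomena.CardyFormulaZ2.Theorems.CardySelfRefinementGradientComparabilityStubDcEqSumPivotal
import Summits.CriticalPhenomena.CardyFormulaZ2.Theorems.CardySelfRefinementGradientComparabilityStubComparabilityFixedMesh
import HarnessLib

/-!
# Crux `GradientComparability` (stmt-CriticalPhenomena-10269), line `Sketch` — stub
# `stub_Dc_pos_of_nonconstant` (POS): `∂cP > 0` wherever `P(ρ,·)` is not constant

Route `CardySelfRefinement`, sub-problem `CriticalPhenomena/CardyFormulaZ2`; vocabulary from
`CardySelfRefinementDefs` (`M`, `P`, `Dc`, `Aloc`, `window`, `cfg`, `prm`, `coinWindow`).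

For the self-refinement model `M_k(ρ,c)` and `η ≠ 0`, `ρ ∈ [0,1]`, `c ∈ (0,1)`: if `P(ρ,·)` is not
constant on `[0,1]` then `∂cP(ρ,c) > 0`.  Proof: `∂cP(ρ,c) = Σ_{non-axial e} M_k(ρ,c)(e pivotal)`
(`stub_Dc_eq_sum_pivotal`, landed); each term is a finite sum of coin-cylinder weights
(`RussoPath.prodBernoulli_real_eq_sum_powerset` for the pulled-back pivotal event, which is
determined by the coin window) whose factors lie in `{½, c, 1−c, ρ, 1−ρ}` (`coe_prm_eq`); if
`∂cP(ρ,c) = 0` then every cylinder of every term has a vanishing factor, necessarily a SELECTOR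
factor `ρ` or `1−ρ`, which vanishes at every `c'`; hence `∂cP(ρ,·) ≡ 0` on `[0,1]` and `P(ρ,·)`,
a polynomial there (`exists_contDiff_eq_P`, `derivWithin_eq_fderiv_snd`), is constant (mean value
inequality with constant `0`) — a contradiction.  This is the (POS) input of the bulk chart's
Kesten-window composition `kestenWindowAlongPath` in `Cruxes/GradientComparability/Lines/Sketch.lean`.
-/

noncomputable section

namespace Summit.CriticalPhenomena.CardyFormulaZ2.Theorems.CardySelfRefinement

open scoped Topology
open Filter Set MeasureTheory
open Literature.Probability.LatticeModels Literature.Probability.Percolation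
open Literature.Probability.Percolation.QuadCrossing
open Summit.CriticalPhenomena.CardyFormulaZ2.Theses.CardySelfRefinement

/-- Membership in `Aloc` depends only on the trace on the window. -/
theorem mem_Aloc_congr_inter {m : ℕ} {F : Fin m → Quad (Set.univ : Set ℂ)} {η : ℝ}
    {ω ω' : BondConfig (Site 2)} (h : ω ∩ window m F η = ω' ∩ window m F η) :
    ω ∈ Aloc m F η ↔ ω' ∈ Aloc m F η := by
  show ω ∩ window m F η ∈ A m F η ↔ ω' ∩ window m F η ∈ A m F η
  rw [h]

/-- The pivotal event of `Aloc` at `e` depends only on the trace on the window. -/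
theorem isPivotal_Aloc_congr_inter {m : ℕ} {F : Fin m → Quad (Set.univ : Set ℂ)} {η : ℝ}
    (e : Sym2 (Site 2)) {ω ω' : BondConfig (Site 2)} (h : ω ∩ window m F η = ω' ∩ window m F η) :
    IsPivotal (Aloc m F η) e ω ↔ IsPivotal (Aloc m F η) e ω' := by
  have key : ∀ x, x ∈ window m F η → (x ∈ ω ↔ x ∈ ω') := fun x hx =>
    ⟨fun hx' => ((Set.ext_iff.1 h x).1 ⟨hx', hx⟩).1, fun hx' => ((Set.ext_iff.1 h x).2 ⟨hx', hx⟩).1⟩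
  have h1 : insert e ω ∩ window m F η = insert e ω' ∩ window m F η := by
    ext x
    simp only [Set.mem_inter_iff, Set.mem_insert_iff]
    constructor
    · rintro ⟨hx | hx, hw⟩
      · exact ⟨Or.inl hx, hw⟩
      · exact ⟨Or.inr ((key x hw).1 hx), hw⟩
    · rintro ⟨hx | hx, hw⟩
      · exact ⟨Or.inl hx, hw⟩
      · exact ⟨Or.inr ((key x hw).2 hx), hw⟩
  have h2 : (ω \ {e}) ∩ window m F η = (ω' \ {e}) ∩ window m F η := by
    ext x
    simp only [Set.mem_inter_iff, Set.mem_sdiff, Set.mem_singleton_iff]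
    constructor
    · rintro ⟨⟨hx, hne⟩, hw⟩
      exact ⟨⟨(key x hw).1 hx, hne⟩, hw⟩
    · rintro ⟨⟨hx, hne⟩, hw⟩
      exact ⟨⟨(key x hw).2 hx, hne⟩, hw⟩
  simp only [IsPivotal, mem_Aloc_congr_inter h1, mem_Aloc_congr_inter h2]

/-- The pulled-back pivotal event is determined by the coin window. -/
theorem determinedBy_preimage_isPivotal_Aloc (k m : ℕ) (F : Fin m → Quad (Set.univ : Set ℂ)) (η : ℝ)
    (e : Sym2 (Site 2)) :
    DeterminedBy ((cfg k) ⁻¹' {ω | IsPivotal (Aloc m F η) e ω}) (coinWindow k (window m F η)) := by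
  rw [determinedBy_iff]
  intro S S' hSS'
  have h : ∀ i ∈ coinWindow k (window m F η), (i ∈ S ↔ i ∈ S') := fun i hi =>
    ⟨fun hS => ((Set.ext_iff.1 hSS' i).1 ⟨hS, hi⟩).1, fun hS' => ((Set.ext_iff.1 hSS' i).2 ⟨hS', hi⟩).1⟩
  simp only [Set.mem_preimage, Set.mem_setOf_eq]
  exact isPivotal_Aloc_congr_inter e (cfg_inter_eq_of_agree k h)

/-- A coin weight that vanishes at an interior `c` is a selector weight, hence vanishes at every
`c'` (parameters inside `[0,1]`, where the clamps are inactive: `coe_prm_eq`). -/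
theorem weight_eq_zero_of_eq_zero (k : ℕ) {ρ c c' : ℝ} (hρ : ρ ∈ Set.Icc (0 : ℝ) 1)
    (hc : c ∈ Set.Ioo (0 : ℝ) 1) (hc' : c' ∈ Set.Icc (0 : ℝ) 1)
    (i : Site 2 × Fin 2 × Fin 3) (b : Bool)
    (h : (if b then (prm k ρ c i : ℝ) else 1 - (prm k ρ c i : ℝ)) = 0) :
    (if b then (prm k ρ c' i : ℝ) else 1 - (prm k ρ c' i : ℝ)) = 0 := by
  have hcI : c ∈ Set.Icc (0 : ℝ) 1 := ⟨hc.1.le, hc.2.le⟩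
  rw [coe_prm_eq k hρ hcI i] at h
  rw [coe_prm_eq k hρ hc' i]
  obtain ⟨v, d, j⟩ := i
  fin_cases j
  · -- own coin: `½` if axial, `c` otherwise — never a zero weight at interior `c`
    exfalso
    by_cases hax : ax k (v, d)
    · cases b
      · simp [hax] at h
        norm_num at h
      · simp [hax] at h
    · cases b
      · simp [hax] at h
        linarith [hc.1, hc.2]
      · simp [hax] at h
        linarith [hc.1, hc.2]
  · -- shared coin: `½`
    exfalso
    cases b
    · simp at h
      norm_num at h
    · simp at h
  · -- selector: `ρ`, independent of `c`
    cases b <;> simpa using h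

/-- **KEY:** if the pivotal probability of an edge vanishes at an interior `c`, it vanishes at every
`c'` (same `ρ`). -/
theorem real_isPivotal_eq_zero_of_eq_zero (k m : ℕ) (F : Fin m → Quad (Set.univ : Set ℂ)) {η : ℝ}
    (hη : η ≠ 0) {ρ : ℝ} (hρ : ρ ∈ Set.Icc (0 : ℝ) 1) {c : ℝ} (hc : c ∈ Set.Ioo (0 : ℝ) 1)
    (e : Sym2 (Site 2)) (h0 : (M k ρ c).real {ω | IsPivotal (Aloc m F η) e ω} = 0)
    {c' : ℝ} (hc' : c' ∈ Set.Icc (0 : ℝ) 1) :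
    (M k ρ c').real {ω | IsPivotal (Aloc m F η) e ω} = 0 := by
  classical
  obtain ⟨K, hK⟩ := exists_coinFinset k m F hη
  have hdet : DeterminedBy ((cfg k) ⁻¹' {ω | IsPivotal (Aloc m F η) e ω}) (↑K : Set _) :=
    hK ▸ determinedBy_preimage_isPivotal_Aloc k m F η e
  have hmeas : MeasurableSet {ω : BondConfig (Site 2) | IsPivotal (Aloc m F η) e ω} :=
    measurableSet_setOf_isPivotal (measurableSet_Aloc m F hη) e
  have hrepr : ∀ c₁ : ℝ, (M k ρ c₁).real {ω | IsPivotal (Aloc m F η) e ω} =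
      ∑ S ∈ K.powerset, if (↑S : Set (Site 2 × Fin 2 × Fin 3)) ∈ (cfg k) ⁻¹' {ω | IsPivotal (Aloc m F η) e ω}
        then ∏ i ∈ K, (if i ∈ S then (prm k ρ c₁ i : ℝ) else 1 - (prm k ρ c₁ i : ℝ)) else 0 := by
    intro c₁
    rw [Measure.real, Measure.map_apply (measurable_cfg k) hmeas, ← Measure.real]
    exact RussoPath.prodBernoulli_real_eq_sum_powerset hdet (prm k ρ c₁)
  rw [hrepr] at h0 ⊢
  -- every summand at `c` is `≥ 0`, so each vanishes; a vanishing product has a zero factor, which is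
  -- a selector weight and vanishes at `c'` as well
  have hnn : ∀ S ∈ K.powerset, 0 ≤ (if (↑S : Set (Site 2 × Fin 2 × Fin 3)) ∈ (cfg k) ⁻¹' {ω | IsPivotal (Aloc m F η) e ω}
        then ∏ i ∈ K, (if i ∈ S then (prm k ρ c i : ℝ) else 1 - (prm k ρ c i : ℝ)) else 0) := by
    intro S _
    split_ifs
    · exact Finset.prod_nonneg fun i _ => by
        split_ifs
        · exact (prm k ρ c i).2.1
        · linarith [(prm k ρ c i).2.2]
    · exact le_rfl
  have hzero := (Finset.sum_eq_zero_iff_of_nonneg hnn).1 h0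
  refine Finset.sum_eq_zero fun S hS => ?_
  have hS0 := hzero S hS
  split_ifs with hmem
  · rw [if_pos hmem] at hS0
    obtain ⟨i, hi, hwi⟩ := Finset.prod_eq_zero_iff.1 hS0
    refine Finset.prod_eq_zero hi ?_
    by_cases hiS : i ∈ S
    · have := weight_eq_zero_of_eq_zero k hρ hc hc' i true (by simpa [hiS] using hwi)
      simpa [hiS] using this
    · have := weight_eq_zero_of_eq_zero k hρ hc hc' i false (by simpa [hiS] using hwi)
      simpa [hiS] using this
  · rfl

/-- **(POS) `∂cP > 0` wherever `P(ρ,·)` is not constant** (registered stub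
`stub_Dc_pos_of_nonconstant` of line `Sketch`). -/
theorem stub_Dc_pos_of_nonconstant (k m : ℕ) (F : Fin m → Quad (Set.univ : Set ℂ)) {η : ℝ} (hη : η ≠ 0)
    {ρ : ℝ} (hρ : ρ ∈ Set.Icc (0 : ℝ) 1) {c : ℝ} (hc : c ∈ Set.Ioo (0 : ℝ) 1)
    (hnc : ¬ ∀ c' ∈ Set.Icc (0 : ℝ) 1, P k m F η ρ c' = P k m F η ρ c) :
    0 < Dc k m F η (ρ, c) := by
  classical
  -- the non-axial window edges
  obtain ⟨W, hW⟩ : ∃ W : Finset (Sym2 (Site 2)),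
      ∀ e, e ∈ W ↔ e ∈ window m F η ∧ ∃ (v : Site 2) (d : Fin 2), e = edgeOf (v, d) ∧ ¬ ax k (v, d) := by
    refine ⟨(window_finite m F hη).toFinset.filter
      (fun e => ∃ (v : Site 2) (d : Fin 2), e = edgeOf (v, d) ∧ ¬ ax k (v, d)), fun e => ?_⟩
    simp only [Finset.mem_filter, Set.Finite.mem_toFinset]
  have hDc : ∀ c₁ ∈ Set.Icc (0 : ℝ) 1,
      Dc k m F η (ρ, c₁) = ∑ e ∈ W, (M k ρ c₁).real {ω | IsPivotal (Aloc m F η) e ω} :=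
    fun c₁ hc₁ => stub_Dc_eq_sum_pivotal k m F hη ρ hc₁ W hW
  have hcI : c ∈ Set.Icc (0 : ℝ) 1 := ⟨hc.1.le, hc.2.le⟩
  -- `Dc ≥ 0`; suppose it vanishes at `c`
  have hnn : 0 ≤ Dc k m F η (ρ, c) := by
    rw [hDc c hcI]; exact Finset.sum_nonneg fun e _ => by positivity
  rcases hnn.lt_or_eq with hpos | hzero
  · exact hpos
  exfalso
  -- then every term vanishes at `c`, hence at every `c'`, so `Dc(ρ,·) ≡ 0` on `[0,1]`
  have hterm : ∀ e ∈ W, (M k ρ c).real {ω | IsPivotal (Aloc m F η) e ω} = 0 := by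
    have h := hzero.symm
    rw [hDc c hcI] at h
    exact (Finset.sum_eq_zero_iff_of_nonneg fun e _ => by positivity).1 h
  have hDc0 : ∀ c' ∈ Set.Icc (0 : ℝ) 1, Dc k m F η (ρ, c') = 0 := by
    intro c' hc'
    rw [hDc c' hc']
    exact Finset.sum_eq_zero fun e he => real_isPivotal_eq_zero_of_eq_zero k m F hη hρ hc e (hterm e he) hc'
  -- `P(ρ,·)` is differentiable within `[0,1]` (a polynomial there), so it is constant on `[0,1]`
  obtain ⟨Φ, hΦ, hPΦ⟩ := exists_contDiff_eq_P k m F hη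
  have hΦd : Differentiable ℝ Φ := hΦ.differentiable (by norm_num)
  have hderiv : ∀ c' ∈ Set.Icc (0 : ℝ) 1,
      HasDerivWithinAt (fun x => P k m F η ρ x) 0 (Set.Icc (0 : ℝ) 1) c' := by
    intro c' hc'
    have hcurve : HasDerivAt (fun x : ℝ => ((ρ, x) : ℝ × ℝ)) ((0 : ℝ), (1 : ℝ)) c' :=
      (hasDerivAt_const c' ρ).prodMk (hasDerivAt_id c')
    have hd : HasDerivAt (fun x : ℝ => Φ (ρ, x)) (fderiv ℝ Φ (ρ, c') (0, 1)) c' :=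
      (hΦd (ρ, c')).hasFDerivAt.comp_hasDerivAt c' hcurve
    have hdw : HasDerivWithinAt (fun x => P k m F η ρ x) (fderiv ℝ Φ (ρ, c') (0, 1)) (Set.Icc (0 : ℝ) 1) c' :=
      hd.hasDerivWithinAt.congr_of_mem (fun x hx => hPΦ ρ hρ x hx) hc'
    have hval : fderiv ℝ Φ (ρ, c') (0, 1) = 0 := by
      rw [← derivWithin_eq_fderiv_snd (hΦd (ρ, c')) hc' (fun x hx => hPΦ ρ hρ x hx)]
      exact hDc0 c' hc'
    rwa [hval] at hdw
  have hconst : ∀ c' ∈ Set.Icc (0 : ℝ) 1, P k m F η ρ c' = P k m F η ρ c := by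
    intro c' hc'
    have h := (convex_Icc (0 : ℝ) 1).norm_image_sub_le_of_norm_hasDerivWithin_le (C := 0)
      (fun x hx => hderiv x hx) (fun x _ => by simp) hcI hc'
    rw [zero_mul, norm_le_zero_iff, sub_eq_zero] at h
    exact h
  exact hnc hconst

end Summit.CriticalPhenomena.CardyFormulaZ2.Theorems.CardySelfRefinement

end
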